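import Summits.QuantumFields.YangMills.Theorems.UnitScaleTiltProp7ProjRangeKernelDecayCoarseGram
import HarnessLib

/-!
# Route `UnitScaleTilt`, crux K1 «MinimiserStabilityRegPr» (stmt-QuantumFields-19200), EX rows `h349` ∕ `hGF` (curved member) — **LOD LINE ENGINE (L5′-core, BLOCK-L² EDITION) (★p1 g24):
# THE BLOCK-TO-BLOCK BILINEAR BOUND FOR `X = B₁ N B₂ᴴ` FROM COLUMN BLOCK NORMS** — `|⟨u, X v⟩| ≤ (Σ_{y,y′} cn₁(z,y)·‖N y y′‖·cn₂(z′,y′))·‖u‖‖v‖` for `u` supported in block `z`,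
# `v` in block `z′`, `cn(z,y) := (Σ_{x ∈ z}‖B x y‖²)^{1∕2}`; and its exponential edition.  This is the K-UNIFORM block-L² sibling of ✓p746782 `P_decay` (whose fine-entry form with
# the weight `√w(x)` needs SUP-norm columns — the `h349` currency): here only the block-L² norms of the columns enter — the currency that (L3′a)'s weighted-L² Agmon row
# (✓p747790 `set_decay_of_hermitian_coshBudget`) delivers and that the γ-row's IMS consumes (CARD-19200-V3-g24 §5; ★★OWNER RULING №35 (1)).

Cell `ym3-torus` (HUMAN RULING D-0037, YM ladder rung R3 — NOT d = 4, NOT a mass gap, NOT Clay).  Fleet lead seat `ym-ust-19200-p1` gen 24.  THEOREMS ONLY (0 `def`, 0 `sorry`), Mathlib +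
this seat's ✓p746782 (for `exp_three_le`); `--supports stmt-QuantumFields-19200 --as helper`, count-neutral.  HONEST LABEL (№33 (6)): curved γ-row supplier line (LOD localisation); ENGINE;
nothing of (3.49), Thm 3.1∕3.3, `h349`, `hGF`, EX ∕ 19200 is proved.  Serves routeR-w2 g12's (L5′-member) «Gram shells» (chair word 22:14Z): `X = P = B M⁻¹Bᴴ` (`B₁ = B₂ = B`,
`N = M⁻¹`) and `X = DP`-type sandwiches (`B₁ :=` the `D`-image columns).

WHAT IS PROVED (ns `Summit.QuantumFields.YangMills.Theorems.Prop7GramSandwichBlockBound`; fine `n`, coarse `m`, block map `blk : n → m`, `B₁ B₂ : Matrix n m ℂ`, `N : Matrix m m ℂ`).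
* §1 `norm_sum_star_mul_col_le` — block Cauchy–Schwarz: `u` supported in block `z` ⟹ `‖Σ_x ū_x·B x y‖ ≤ ‖u‖₂·cn(z,y)`.
* §2 ★★★ `norm_form_sandwich_le` — THE BILINEAR BOUND above for `X = B₁ * N * B₂ᴴ`.
* §3 ★★★ `norm_form_sandwich_le_exp` — with `cn₁(z,y) ≤ C₁e^{−μ dc(z,y)}`, `cn₂ ≤ C₂e^{−μ dc}`, `‖N y y′‖ ≤ C_N e^{−μ′dc(y,y′)}`, coarse volume `Σ_z e^{−(μ−μ′)dc(z,y)} ≤ cV′`: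
  `|⟨u, Xv⟩| ≤ C₁C₂C_N·cV′²·e^{−μ′ dc(z,z′)}·‖u‖₂‖v‖₂` — block-to-block decay of `P`, `DP`, `DPD*`-type operators, K-uniform on the face of the statement.

References: T. Bałaban, CMP **99** (1985) 389–434 [Balaban1985BackgroundPropagators] ((3.21) p.394, (3.49) p.399); A. Målqvist, D. Peterseim, Math. Comp. **83** (2014) 2583–2603.
-/

set_option autoImplicit false

noncomputable section

open scoped Matrix ComplexConjugate BigOperators
open Finset

namespace Summit.QuantumFields.YangMills.Theorems.Prop7GramSandwichBlockBound

open Summit.QuantumFields.YangMills.Theorems.Prop7ProjRangeKernelDecayCoarseGram (exp_three_le)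

variable {n m : Type*} [Fintype n] [Fintype m] [DecidableEq m]

/-! ## §1 Block Cauchy–Schwarz -/

omit [Fintype m] in
/-- **BLOCK CAUCHY–SCHWARZ**: if `u x = 0` off the block `z`, then `‖Σ_x ū_x·B x y‖ ≤ ‖u‖₂·(Σ_{x ∈ z}‖B x y‖²)^{1∕2}`. [cite: Balaban1985BackgroundPropagators, (3.46) p.398] -/
theorem norm_sum_star_mul_col_le (blk : n → m) (B : Matrix n m ℂ) (u : n → ℂ) (z : m) (hu : ∀ x, blk x ≠ z → u x = 0) (y : m) :
    ‖∑ x, star (u x) * B x y‖ ≤ Real.sqrt (∑ x, ‖u x‖ ^ 2) * Real.sqrt (∑ x ∈ univ.filter (fun x => blk x = z), ‖B x y‖ ^ 2) := by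
  classical
  have hsplit : ∑ x, star (u x) * B x y = ∑ x ∈ univ.filter (fun x => blk x = z), star (u x) * B x y := by
    rw [← Finset.sum_filter_add_sum_filter_not univ (fun x => blk x = z), Finset.sum_eq_zero (s := univ.filter fun x => ¬ blk x = z), add_zero]
    intro x hx; rw [hu x (Finset.mem_filter.mp hx).2, star_zero, zero_mul]
  rw [hsplit]
  refine (norm_sum_le _ _).trans ?_
  have h1 : ∑ x ∈ univ.filter (fun x => blk x = z), ‖star (u x) * B x y‖ = ∑ x ∈ univ.filter (fun x => blk x = z), ‖u x‖ * ‖B x y‖ :=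
    Finset.sum_congr rfl fun x _ => by rw [norm_mul, norm_star]
  rw [h1]
  refine (Real.sum_mul_le_sqrt_mul_sqrt _ _ _).trans ?_
  refine mul_le_mul_of_nonneg_right (Real.sqrt_le_sqrt ?_) (Real.sqrt_nonneg _)
  exact Finset.sum_le_univ_sum_of_nonneg fun x => by positivity

/-! ## §2 The bilinear sandwich bound -/

/-- ★★★ **THE BLOCK-TO-BLOCK BILINEAR BOUND**: for `u` supported in block `z` and `v` in block `z′`,
`‖Σ_{x,x′} ū_x (B₁NB₂ᴴ)_{xx′} v_{x′}‖ ≤ (Σ_{y,y′} cn₁(z,y)·‖N y y′‖·cn₂(z′,y′))·‖u‖₂·‖v‖₂`. [cite: Balaban1985BackgroundPropagators, (3.49) p.399] -/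
theorem norm_form_sandwich_le (blk : n → m) (B₁ B₂ : Matrix n m ℂ) (N : Matrix m m ℂ) (u v : n → ℂ) (z z' : m)
    (hu : ∀ x, blk x ≠ z → u x = 0) (hv : ∀ x, blk x ≠ z' → v x = 0) :
    ‖∑ x, star (u x) * ((B₁ * N * B₂ᴴ) *ᵥ v) x‖
      ≤ (∑ y, ∑ y', Real.sqrt (∑ x ∈ univ.filter (fun x => blk x = z), ‖B₁ x y‖ ^ 2) * ‖N y y'‖ *
            Real.sqrt (∑ x ∈ univ.filter (fun x => blk x = z'), ‖B₂ x y'‖ ^ 2))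
        * (Real.sqrt (∑ x, ‖u x‖ ^ 2) * Real.sqrt (∑ x, ‖v x‖ ^ 2)) := by
  -- the form as `(ū ᵥ* B₁) ⬝ᵥ (N *ᵥ (B₂ᴴ *ᵥ v))`
  have hform : ∑ x, star (u x) * ((B₁ * N * B₂ᴴ) *ᵥ v) x
      = ∑ y, (star u ᵥ* B₁) y * ∑ y', N y y' * (B₂ᴴ *ᵥ v) y' := by
    have h0 : ∑ x, star (u x) * ((B₁ * N * B₂ᴴ) *ᵥ v) x = star u ⬝ᵥ ((B₁ * N * B₂ᴴ) *ᵥ v) := rfl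
    rw [h0, ← Matrix.mulVec_mulVec, ← Matrix.mulVec_mulVec, Matrix.dotProduct_mulVec]
    rfl
  rw [hform]
  -- the two block Cauchy–Schwarz bounds
  have ha : ∀ y, ‖(star u ᵥ* B₁) y‖ ≤ Real.sqrt (∑ x, ‖u x‖ ^ 2) * Real.sqrt (∑ x ∈ univ.filter (fun x => blk x = z), ‖B₁ x y‖ ^ 2) := by
    intro y
    have h := norm_sum_star_mul_col_le blk B₁ u z hu y
    have heq : (star u ᵥ* B₁) y = ∑ x, star (u x) * B₁ x y := rfl
    rw [heq]; exact h
  have hb : ∀ y', ‖(B₂ᴴ *ᵥ v) y'‖ ≤ Real.sqrt (∑ x, ‖v x‖ ^ 2) * Real.sqrt (∑ x ∈ univ.filter (fun x => blk x = z'), ‖B₂ x y'‖ ^ 2) := by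
    intro y'
    have h := norm_sum_star_mul_col_le blk B₂ v z' hv y'
    have heq : (B₂ᴴ *ᵥ v) y' = star (∑ x', star (v x') * B₂ x' y') := by
      rw [Matrix.mulVec, dotProduct, star_sum]
      refine Finset.sum_congr rfl fun x' _ => ?_
      rw [Matrix.conjTranspose_apply, star_mul, star_star, mul_comm]
    rw [heq, norm_star]; exact h
  refine (norm_sum_le _ _).trans ?_
  have hstep : ∀ y, ‖(star u ᵥ* B₁) y * ∑ y', N y y' * (B₂ᴴ *ᵥ v) y'‖
      ≤ ∑ y', Real.sqrt (∑ x ∈ univ.filter (fun x => blk x = z), ‖B₁ x y‖ ^ 2) * ‖N y y'‖ *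
          Real.sqrt (∑ x ∈ univ.filter (fun x => blk x = z'), ‖B₂ x y'‖ ^ 2) * (Real.sqrt (∑ x, ‖u x‖ ^ 2) * Real.sqrt (∑ x, ‖v x‖ ^ 2)) := by
    intro y
    rw [norm_mul]
    have h2 : ‖∑ y', N y y' * (B₂ᴴ *ᵥ v) y'‖ ≤ ∑ y', ‖N y y'‖ * (Real.sqrt (∑ x, ‖v x‖ ^ 2) * Real.sqrt (∑ x ∈ univ.filter (fun x => blk x = z'), ‖B₂ x y'‖ ^ 2)) := by
      refine (norm_sum_le _ _).trans (Finset.sum_le_sum fun y' _ => ?_)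
      rw [norm_mul]
      exact mul_le_mul_of_nonneg_left (hb y') (norm_nonneg _)
    calc ‖(star u ᵥ* B₁) y‖ * ‖∑ y', N y y' * (B₂ᴴ *ᵥ v) y'‖
        ≤ (Real.sqrt (∑ x, ‖u x‖ ^ 2) * Real.sqrt (∑ x ∈ univ.filter (fun x => blk x = z), ‖B₁ x y‖ ^ 2)) *
            ∑ y', ‖N y y'‖ * (Real.sqrt (∑ x, ‖v x‖ ^ 2) * Real.sqrt (∑ x ∈ univ.filter (fun x => blk x = z'), ‖B₂ x y'‖ ^ 2)) :=
          mul_le_mul (ha y) h2 (norm_nonneg _) (by positivity)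
      _ = _ := by
          rw [Finset.mul_sum]
          refine Finset.sum_congr rfl fun y' _ => ?_
          ring
  refine (Finset.sum_le_sum fun y _ => hstep y).trans (le_of_eq ?_)
  rw [Finset.sum_mul]
  refine Finset.sum_congr rfl fun y _ => ?_
  rw [Finset.sum_mul]

/-! ## §3 Exponential edition -/

/-- ★★★ **BLOCK-TO-BLOCK DECAY OF THE SANDWICH**: column block norms `cn₁(z,y) ≤ C₁e^{−μ dc(z,y)}`, `cn₂(z′,y′) ≤ C₂e^{−μ dc(z′,y′)}`, `‖N y y′‖ ≤ C_N e^{−μ′dc(y,y′)}`, coarse volume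
`Σ_y e^{−(μ−μ′)dc(y,z)} ≤ cV′` ⟹ `|⟨u,(B₁NB₂ᴴ)v⟩| ≤ C₁C₂C_N·cV′²·e^{−μ′dc(z,z′)}·‖u‖₂‖v‖₂` for `u` in block `z`, `v` in block `z′`.
[cite: Balaban1985BackgroundPropagators, (3.49) p.399] -/
theorem norm_form_sandwich_le_exp (dc : m → m → ℝ) (hds : ∀ i j, dc i j = dc j i) (hdt : ∀ i j k, dc i k ≤ dc i j + dc j k)
    (blk : n → m) (B₁ B₂ : Matrix n m ℂ) (N : Matrix m m ℂ) {C₁ C₂ CN μ μ' cV' : ℝ} (hC₁ : 0 ≤ C₁) (hC₂ : 0 ≤ C₂) (hCN : 0 ≤ CN) (hμ' : 0 ≤ μ')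
    (hB₁ : ∀ z y, Real.sqrt (∑ x ∈ univ.filter (fun x => blk x = z), ‖B₁ x y‖ ^ 2) ≤ C₁ * Real.exp (-(μ * dc z y)))
    (hB₂ : ∀ z y, Real.sqrt (∑ x ∈ univ.filter (fun x => blk x = z), ‖B₂ x y‖ ^ 2) ≤ C₂ * Real.exp (-(μ * dc z y)))
    (hN : ∀ y y', ‖N y y'‖ ≤ CN * Real.exp (-(μ' * dc y y')))
    (hvol' : ∀ z, ∑ y, Real.exp (-((μ - μ') * dc y z)) ≤ cV')
    (u v : n → ℂ) (z z' : m) (hu : ∀ x, blk x ≠ z → u x = 0) (hv : ∀ x, blk x ≠ z' → v x = 0) :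
    ‖∑ x, star (u x) * ((B₁ * N * B₂ᴴ) *ᵥ v) x‖
      ≤ C₁ * C₂ * CN * cV' ^ 2 * Real.exp (-(μ' * dc z z')) * (Real.sqrt (∑ x, ‖u x‖ ^ 2) * Real.sqrt (∑ x, ‖v x‖ ^ 2)) := by
  have hcV' : 0 ≤ cV' := le_trans (Finset.sum_nonneg fun y _ => (Real.exp_pos _).le) (hvol' z)
  refine (norm_form_sandwich_le blk B₁ B₂ N u v z z' hu hv).trans (mul_le_mul_of_nonneg_right ?_ (by positivity))
  -- termwise
  have hterm : ∀ y y', Real.sqrt (∑ x ∈ univ.filter (fun x => blk x = z), ‖B₁ x y‖ ^ 2) * ‖N y y'‖ *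
        Real.sqrt (∑ x ∈ univ.filter (fun x => blk x = z'), ‖B₂ x y'‖ ^ 2)
      ≤ C₁ * C₂ * CN * Real.exp (-(μ' * dc z z')) * (Real.exp (-((μ - μ') * dc z y)) * Real.exp (-((μ - μ') * dc z' y'))) := by
    intro y y'
    have ht : dc z z' ≤ dc z y + dc y y' + dc z' y' := by
      have := hdt z y z'; have h2 := hdt y y' z'; rw [hds y' z'] at h2; linarith
    have h3 := exp_three_le (μ := μ) (a := dc z y) (b := dc y y') (c := dc z' y') hμ' ht
    calc Real.sqrt (∑ x ∈ univ.filter (fun x => blk x = z), ‖B₁ x y‖ ^ 2) * ‖N y y'‖ * Real.sqrt (∑ x ∈ univ.filter (fun x => blk x = z'), ‖B₂ x y'‖ ^ 2)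
        ≤ (C₁ * Real.exp (-(μ * dc z y))) * (CN * Real.exp (-(μ' * dc y y'))) * (C₂ * Real.exp (-(μ * dc z' y'))) :=
          mul_le_mul (mul_le_mul (hB₁ z y) (hN y y') (norm_nonneg _) (by positivity)) (hB₂ z' y') (Real.sqrt_nonneg _) (by positivity)
      _ = C₁ * C₂ * CN * (Real.exp (-(μ * dc z y)) * Real.exp (-(μ' * dc y y')) * Real.exp (-(μ * dc z' y'))) := by ring
      _ ≤ C₁ * C₂ * CN * (Real.exp (-(μ' * dc z z')) * (Real.exp (-((μ - μ') * dc z y)) * Real.exp (-((μ - μ') * dc z' y')))) :=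
          mul_le_mul_of_nonneg_left h3 (by positivity)
      _ = _ := by ring
  refine (Finset.sum_le_sum fun y _ => Finset.sum_le_sum fun y' _ => hterm y y').trans ?_
  have hsum : ∑ y, ∑ y', C₁ * C₂ * CN * Real.exp (-(μ' * dc z z')) * (Real.exp (-((μ - μ') * dc z y)) * Real.exp (-((μ - μ') * dc z' y')))
      = C₁ * C₂ * CN * Real.exp (-(μ' * dc z z')) * ((∑ y, Real.exp (-((μ - μ') * dc z y))) * ∑ y', Real.exp (-((μ - μ') * dc z' y'))) := by
    rw [Finset.sum_mul, Finset.mul_sum]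
    refine Finset.sum_congr rfl fun y _ => ?_
    rw [Finset.mul_sum, Finset.mul_sum]
  rw [hsum]
  have ha : ∑ y, Real.exp (-((μ - μ') * dc z y)) ≤ cV' := by have := hvol' z; simpa [hds] using this
  have hb : ∑ y', Real.exp (-((μ - μ') * dc z' y')) ≤ cV' := by have := hvol' z'; simpa [hds] using this
  have hab : (∑ y, Real.exp (-((μ - μ') * dc z y))) * ∑ y', Real.exp (-((μ - μ') * dc z' y')) ≤ cV' * cV' :=
    mul_le_mul ha hb (Finset.sum_nonneg fun _ _ => (Real.exp_pos _).le) hcV'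
  calc C₁ * C₂ * CN * Real.exp (-(μ' * dc z z')) * ((∑ y, Real.exp (-((μ - μ') * dc z y))) * ∑ y', Real.exp (-((μ - μ') * dc z' y')))
      ≤ C₁ * C₂ * CN * Real.exp (-(μ' * dc z z')) * (cV' * cV') := mul_le_mul_of_nonneg_left hab (by positivity)
    _ = C₁ * C₂ * CN * cV' ^ 2 * Real.exp (-(μ' * dc z z')) := by ring

end Summit.QuantumFields.YangMills.Theorems.Prop7GramSandwichBlockBound

end
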